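import Summits.QuantumFields.YangMills.Theses.MirrorModularBoosts

/-!
# `MirrorModularBoosts.Assembly` — the assembly item of route `MirrorModularBoosts`

Route `MirrorModularBoosts` (sub-problem `YangMills` of summit `QuantumFields`) files, as its assembly
item `Assembly` (stmt-QuantumFields-10707, rewired 2026-08-15 after the refutation of the first-filing
crux `DiagonalMirrorRP` in favour of the repaired crux `DiagonalMirrorRPR`), the implication chain

`CurvatureBoostCovariance → PlanarSpectralCone → DiagonalMirrorRPR → HypercubicLimit →
 CurvatureChannel → SpeciesProjectionPlanar → PlanarToEuclidean → YangMills`.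

This is *verbatim* the type of the route's deciding theorem
`Summit.QuantumFields.YangMills.Theses.MirrorModularBoosts.closes` (planner-authored, sorry-free,
kernel-checked with the route file: the eight oriented mirror lines of the `(x₀,x₁)`-plane by the case
split `a = 0 ∨ b = 0 ∨ a² = b²`, the planar spectral cone, the modular-boost engine, species
projection, the group-theoretic upgrade `PlanarToEuclidean`, and the packaging of the
Osterwalder–Schrader data into the clauses of `YangMills`). This file closes the item by that
definitional unfolding; it adds no mathematics of its own.

Sources: route-internal (the deciding theorem `closes`); Osterwalder–Schrader 1975 and
Jaffe–Witten 2000 for the axioms packaged in `YangMills`.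
Deliberately NOT here: any of the four cruxes (`HypercubicLimit`, `DiagonalMirrorRPR`,
`PlanarSpectralCone`, `CurvatureBoostCovariance`) — they stay open items of the route.
-/

namespace Summit.QuantumFields.YangMills.Theorems

/-- **`MirrorModularBoosts.Assembly` holds** (assembly item stmt-QuantumFields-10707): the chain
`CurvatureBoostCovariance → PlanarSpectralCone → DiagonalMirrorRPR → HypercubicLimit →
CurvatureChannel → SpeciesProjectionPlanar → PlanarToEuclidean → YangMills`.
Proof: after unfolding, the goal is literally the type of the route's sorry-free deciding theorem
`MirrorModularBoosts.closes`. [folklore] -/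
theorem mirrorModularBoosts_assembly_proof :
    Summit.QuantumFields.YangMills.Theses.MirrorModularBoosts.Assembly := by
  unfold Summit.QuantumFields.YangMills.Theses.MirrorModularBoosts.Assembly
  exact Summit.QuantumFields.YangMills.Theses.MirrorModularBoosts.closes

end Summit.QuantumFields.YangMills.Theorems
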